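import Summits.QuantumFields.YangMills.Theorems.LangevinControlUVOSLegsAtWeakCouplingCStubLocalityCut
import Summits.QuantumFields.YangMills.Theorems.LangevinControlUVOSLegsAtWeakCouplingCStubLocalityBumpBounds
import Literature.MathematicalPhysics.QuantumFieldTheory.OSLogSlotSector
import HarnessLib

/-!
# The holomorphic extension of the product-bump function in the gap coordinates (E1-locality — file C2)

Helper file for stub `stub_locality` of crux `OSLegsAtWeakCouplingC` (stmt-QuantumFields-16207, line `Sketch`,
continuation lead c2): the analytic core `exists_holomorphic_extension_bumpFn`.

For a one-field family `S₁` that is translation invariant on `⁰𝒮`, symmetric (E3), reflection positive on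
positive-time tuples (`RPPos`), invariant under the signed permutations of the axes (so that EVERY coordinate axis
is a time axis for Osterwalder–Schrader reconstruction) and has bounded densities off the diagonal, and for a
radial real profile `ρ` supported in the closed `r`-ball with `4r < ε`, the product-bump function
`u ↦ 𝒰(conf ε σ u) = S₁(⊗ᵢ ρ(· − conf ε σ u i))` of the gap coordinates `u` (file A) extends from the open
positive orthant to a function holomorphic on the sector region `{Re wⱼ > 0, Σⱼ |arg wⱼ| < π/2}` of
`ℂ^{4(q+1)}` — Osterwalder–Schrader II, Ch. V (5.7)–(5.8), through the tree's sector engine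
`LogSlot.exists_holomorphic_extension_sectorRegion` (flat tube theorem in the logarithmic variables).  Its slot
along the gap `j = (μ, g)` is the one-slot two-cluster continuation `M(Ψ_X, e^{−τH}Ψ_U)` of
`exists_twoCluster_continuation` for the cut of file B (axis `μ` swapped into the time slot, lower cluster
reflected and reversed, upper cluster shifted down by `ε/4` so that the slot is `τ ↦ M(…)(τ + ε/4)`, defined and
holomorphic past the closed sector); the gaps are clamped to the closed orthant so that the slots are globally
continuous; every bound the engine asks for is a CONSTANT by the density bounds of file C1.
Refs: OsterwalderSchraderCMP1975 Ch. V (5.4)–(5.8); GlimmJaffe1987 §19.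
-/

set_option autoImplicit false

noncomputable section

open scoped BigOperators

namespace Summit.QuantumFields.YangMills.Theorems.OSLegsAtWeakCouplingC.Loc

open scoped ComplexConjugate SchwartzMap InnerProductSpace
open MeasureTheory Filter Topology
open Literature.MathematicalPhysics.QuantumLattice Literature.MathematicalPhysics.AQFT
open Literature.MathematicalPhysics.QuantumFieldTheory
open Literature.MathematicalPhysics.QuantumLattice.SchwingerFamily (timeVec timeVec_add)
open Literature.Analysis.Complex (sectorRegion)
open Literature.MathematicalPhysics.QuantumFieldTheory.LogSlot (openSector)
open Summit.QuantumFields.YangMills.Cruxes.OSLegsFromFemtoAndGap.DlrCollarTransfer (RPPos)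
open Summit.QuantumFields.YangMills.Cruxes.OSLegsAtWeakCouplingC.Sketch (OffDiagDensity Separated IsSignedPerm Invariant)

section Sector

variable {q : ℕ}

/-- Clamping the gaps to the closed orthant. -/
theorem continuous_clamp (k : ℕ) : Continuous fun (u : Fin k → ℝ) (l : Fin k) => max (u l) 0 :=
  continuous_pi fun l => (continuous_apply l).max continuous_const

/-- Clamping commutes with inserting a non-negative slot value. -/
theorem clamp_insertNth (j : Fin (4 * q + 3 + 1)) {x : ℝ} (hx : 0 ≤ x) (u' : Fin (4 * q + 3) → ℝ) :
    (fun l => max ((j.insertNth x u' : Fin (4 * q + 3 + 1) → ℝ) l) 0) =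
      (j.insertNth x (fun l => max (u' l) 0) : Fin (4 * q + 3 + 1) → ℝ) := by
  funext l
  induction l using Fin.succAboveCases j with
  | x => simp [max_eq_left hx]
  | p l' => simp [Fin.insertNth_apply_succAbove]

/-- The clamped gaps are in the closed orthant. -/
theorem clamp_nonneg {k : ℕ} (u : Fin k → ℝ) (l : Fin k) : 0 ≤ max (u l) 0 := le_max_right _ _

/-- Inserting `0` into clamped gaps stays in the closed orthant. -/
theorem insertNth_zero_clamp_nonneg (j : Fin (4 * q + 3 + 1)) (u' : Fin (4 * q + 3) → ℝ) (l : Fin (4 * q + 3 + 1)) :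
    0 ≤ (j.insertNth (0 : ℝ) (fun l => max (u' l) 0) : Fin (4 * q + 3 + 1) → ℝ) l := by
  induction l using Fin.succAboveCases j with
  | x => simp
  | p l' => simp [Fin.insertNth_apply_succAbove]

/-- **Separation of the configuration in every pair** (for the density bounds): on the closed orthant two distinct
points are `≥ ε` apart. -/
theorem le_dist_conf {ε : ℝ} (hε : 0 ≤ ε) (σ : Fin 4 → Equiv.Perm (Fin (q + 2))) {u : Fin (4 * q + 3 + 1) → ℝ}
    (hu : ∀ l, 0 ≤ u l) {i j : Fin (q + 2)} (hij : i ≠ j) : ε ≤ dist (conf ε σ u i) (conf ε σ u j) :=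
  (le_abs_conf_sub_conf hε σ hu hij 0).trans (abs_apply_zero_sub_le _ _)

variable {S₁ : SchwingerFamily (EuclideanSpace ℝ (Fin 4))}

/-- **The holomorphic extension of the product-bump function in the gap coordinates** (Osterwalder–Schrader's
(5.8) for a one-field family with reflection positivity along EVERY axis).  For a one-field family `S₁` that is
translation invariant on `⁰𝒮`, symmetric (E3), reflection positive on positive-time tuples (`RPPos`), invariant
under the signed permutations of the axes and with bounded densities off the diagonal, and for a radial real profile
`ρ` supported in the closed `r`-ball with `4r < ε`: the function `u ↦ 𝒰(conf ε σ u) = S₁(⊗ᵢ ρ(· − conf ε σ u i))`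
on the open positive orthant of the `4(q+1)` gap coordinates is the restriction of a function holomorphic on the
sector region `{Re wⱼ > 0, Σⱼ |arg wⱼ| < π/2}`.  Mechanism: the OS sector engine
`LogSlot.exists_holomorphic_extension_sectorRegion`, whose slot along the gap `j = (μ, g)` is the two-cluster
continuation `M(Ψ_X, e^{−τH} Ψ_U)` (`exists_twoCluster_continuation`) of the cut at that gap after the axis `μ`
has been swapped into the time slot (file B); all bounds are uniform by the density bounds of file C1. -/
theorem exists_holomorphic_extension_bumpFn
    (htrans : ∀ (n : ℕ) (t : EuclideanSpace ℝ (Fin 4)) (F : 𝓢((Fin n → EuclideanSpace ℝ (Fin 4)), ℂ)),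
      IsOffDiagonal F → S₁ n (translateMulti t F) = S₁ n F)
    (hE3 : S₁.toLabelled.IsSymmetric) (hRP : RPPos S₁)
    (hsigned : ∀ R : EuclideanSpace ℝ (Fin 4) ≃ₗᵢ[ℝ] EuclideanSpace ℝ (Fin 4), IsSignedPerm R → Invariant S₁ R)
    (hdens : OffDiagDensity S₁)
    {ρ : 𝓢(EuclideanSpace ℝ (Fin 4), ℂ)} {r ε : ℝ}
    (hρ : tsupport (ρ : EuclideanSpace ℝ (Fin 4) → ℂ) ⊆ Metric.closedBall 0 r) (hr0 : 0 ≤ r) (hr : 4 * r < ε)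
    (hρP : ∀ (P : EuclideanSpace ℝ (Fin 4) ≃ₗᵢ[ℝ] EuclideanSpace ℝ (Fin 4)) (x : EuclideanSpace ℝ (Fin 4)), ρ (P x) = ρ x)
    (hρre : ∀ x, conj (ρ x) = ρ x) (σ : Fin 4 → Equiv.Perm (Fin (q + 2))) :
    ∃ G : (Fin (4 * q + 3 + 1) → ℂ) → ℂ, DifferentiableOn ℂ G (sectorRegion (4 * q + 3) (Real.pi / 2)) ∧
      ∀ u : Fin (4 * q + 3 + 1) → ℝ, (∀ j, 0 < u j) → G (fun j => (u j : ℂ)) = bumpFn ρ S₁ (q + 2) (conf ε σ u) := by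
  have hε : 0 < ε := by linarith
  have hε0 : 0 ≤ ε := hε.le
  have h2r : 2 * r < ε := by linarith
  have hρθ : ∀ x, ρ (timeReflection 4 x) = ρ x := fun x => hρP _ x
  -- reconstruction data and the two-cluster continuation
  have h := osRec hRP htrans
  obtain ⟨M, hreal, hholo, -, hbd, hlip⟩ := exists_twoCluster_continuation h
  -- density constants at distance `δ = ε/2 − 2r`
  set δ : ℝ := ε / 2 - 2 * r with hδ
  have hδ0 : 0 < δ := by rw [hδ]; linarith
  choose B hB using fun n => hdens n δ hδ0
  have hB' : ∀ (n : ℕ) (F : 𝓢((Fin n → EuclideanSpace ℝ (Fin 4)), ℂ)),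
      HasCompactSupport (F : (Fin n → EuclideanSpace ℝ (Fin 4)) → ℂ) →
      tsupport (F : (Fin n → EuclideanSpace ℝ (Fin 4)) → ℂ) ⊆ Separated n δ → ‖S₁ n F‖ ≤ |B n| * ∫ x, ‖F x‖ :=
    fun n F h1 h2 => (hB n F h1 h2).trans (mul_le_mul_of_nonneg_right (le_abs_self _) (integral_nonneg fun _ => norm_nonneg _))
  set I : ℝ := ∫ y, ‖ρ y‖ with hI
  -- the clusters as functions of the slot and the reduced gaps (clamped to the closed orthant)
  set cX : (j : Fin (4 * q + 3 + 1)) → (Fin (4 * q + 3) → ℝ) → Fin (((gapEquiv q j).2 : ℕ) + 1) → EuclideanSpace ℝ (Fin 4) :=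
    fun j u' p => timeReflection 4 (loC ε σ (j.insertNth (0 : ℝ) (fun l => max (u' l) 0)) (gapEquiv q j).1 (gapEquiv q j).2 (Fin.rev p))
    with hcX
  set cU : (j : Fin (4 * q + 3 + 1)) → (Fin (4 * q + 3) → ℝ) → Fin (q + 1 - (gapEquiv q j).2) → EuclideanSpace ℝ (Fin 4) :=
    fun j u' p => upC ε σ (j.insertNth (0 : ℝ) (fun l => max (u' l) 0)) (gapEquiv q j).1 (gapEquiv q j).2 p + timeVec (-(ε / 4))
    with hcU
  -- their times: `≥ ε/4`, gaps `≥ ε`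
  have hXt : ∀ j u', (∀ p, ε / 2 ≤ cX j u' p 0) ∧ (∀ p p', p < p' → ε ≤ cX j u' p' 0 - cX j u' p 0) := fun j u' =>
    times_reflect_loC hε0 σ (insertNth_zero_clamp_nonneg j u') _ _
  have hUt : ∀ j u', (∀ p, ε / 4 ≤ cU j u' p 0) ∧ (∀ p p', p < p' → ε ≤ cU j u' p' 0 - cU j u' p 0) := by
    intro j u'
    obtain ⟨h1, h2⟩ := times_upC hε0 σ (insertNth_zero_clamp_nonneg j u') (gapEquiv q j).1 (gapEquiv q j).2
    refine ⟨fun p => ?_, fun p p' hpp' => ?_⟩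
    · simp only [hcU, PiLp.add_apply, timeVec_apply_zero']
      linarith [h1 p]
    · simp only [hcU, PiLp.add_apply, timeVec_apply_zero']
      linarith [h2 p p' hpp']
  have hX : ∀ j u', IsTimeOrdered (prodBumps ρ (((gapEquiv q j).2 : ℕ) + 1) (cX j u')) := fun j u' =>
    isTimeOrdered_prodBumps ρ hρ (fun p => by linarith [(hXt j u').1 p]) (fun p p' hpp' => by linarith [(hXt j u').2 p p' hpp'])
  have hU : ∀ j u', IsTimeOrdered (prodBumps ρ (q + 1 - (gapEquiv q j).2) (cU j u')) := fun j u' =>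
    isTimeOrdered_prodBumps ρ hρ (fun p => by linarith [(hUt j u').1 p]) (fun p p' hpp' => by linarith [(hUt j u').2 p p' hpp'])
  -- pairwise separation `≥ ε/2` (in fact `≥ ε`) inside each cluster
  have hsepX : ∀ j u' p p', p ≠ p' → 2 * (ε / 4) ≤ dist (cX j u' p) (cX j u' p') := by
    intro j u' p p' hpp'
    have h0 := abs_apply_zero_sub_le (cX j u' p) (cX j u' p')
    rcases lt_or_gt_of_ne hpp' with hlt | hlt
    · have := (hXt j u').2 p p' hlt; rw [abs_sub_comm] at h0; rw [abs_of_nonneg (by linarith)] at h0; linarith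
    · have := (hXt j u').2 p' p hlt; rw [abs_of_nonneg (by linarith)] at h0; linarith
  have hsepU : ∀ j u' p p', p ≠ p' → 2 * (ε / 4) ≤ dist (cU j u' p) (cU j u' p') := by
    intro j u' p p' hpp'
    have h0 := abs_apply_zero_sub_le (cU j u' p) (cU j u' p')
    rcases lt_or_gt_of_ne hpp' with hlt | hlt
    · have := (hUt j u').2 p p' hlt; rw [abs_sub_comm] at h0; rw [abs_of_nonneg (by linarith)] at h0; linarith
    · have := (hUt j u').2 p' p hlt; rw [abs_of_nonneg (by linarith)] at h0; linarith
  -- the OS field vectors and their uniform bounds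
  set ψX : (j : Fin (4 * q + 3 + 1)) → (Fin (4 * q + 3) → ℝ) → h.Hilbert :=
    fun j u' => h.fieldVec _ (fun _ => ()) (prodBumps ρ _ (cX j u')) (hX j u') with hψX
  set ψU : (j : Fin (4 * q + 3 + 1)) → (Fin (4 * q + 3) → ℝ) → h.Hilbert :=
    fun j u' => h.fieldVec _ (fun _ => ()) (prodBumps ρ _ (cU j u')) (hU j u') with hψU
  set KX : Fin (4 * q + 3 + 1) → ℝ := fun j =>
    Real.sqrt (|B ((((gapEquiv q j).2 : ℕ) + 1) + (((gapEquiv q j).2 : ℕ) + 1))| *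
      I ^ ((((gapEquiv q j).2 : ℕ) + 1) + (((gapEquiv q j).2 : ℕ) + 1))) with hKX
  set KU : Fin (4 * q + 3 + 1) → ℝ := fun j =>
    Real.sqrt (|B ((q + 1 - (gapEquiv q j).2) + (q + 1 - (gapEquiv q j).2))| * I ^ ((q + 1 - (gapEquiv q j).2) + (q + 1 - (gapEquiv q j).2)))
    with hKU
  have hδη : δ + 2 * r ≤ 2 * (ε / 4) := by rw [hδ]; linarith
  have hψXb : ∀ j u', ‖ψX j u'‖ ≤ KX j := fun j u' =>
    norm_fieldVec_prodBumps_le h hρ hρθ hρre (hB' _) (by linarith) hδη (fun p => by linarith [(hXt j u').1 p]) (hsepX j u') (hX j u')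
  have hψUb : ∀ j u', ‖ψU j u'‖ ≤ KU j := fun j u' =>
    norm_fieldVec_prodBumps_le h hρ hρθ hρre (hB' _) (by linarith) hδη (fun p => (hUt j u').1 p) (hsepU j u') (hU j u')
  -- continuity of the field vectors in the reduced gaps
  have hcXc : ∀ j, Continuous (cX j) := by
    intro j
    refine continuous_pi fun p => (timeReflection 4).continuous.comp ?_
    exact (continuous_apply _).comp ((continuous_cutConf ε σ _ _).comp
      ((Continuous.finInsertNth j continuous_const (continuous_clamp _))))
  have hcUc : ∀ j, Continuous (cU j) := by
    intro j
    refine continuous_pi fun p => Continuous.add ?_ continuous_const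
    exact (continuous_apply _).comp ((continuous_cutConf ε σ _ _).comp
      ((Continuous.finInsertNth j continuous_const (continuous_clamp _))))
  have hψXc : ∀ j, Continuous (ψX j) := fun j =>
    continuous_iff_continuousAt.2 fun u₀ =>
      tendsto_fieldVec h (fun u' => hX j u') (hX j u₀) (((continuous_prodBumps ρ).comp (hcXc j)).tendsto u₀)
  have hψUc : ∀ j, Continuous (ψU j) := fun j =>
    continuous_iff_continuousAt.2 fun u₀ =>
      tendsto_fieldVec h (fun u' => hU j u') (hU j u₀) (((continuous_prodBumps ρ).comp (hcUc j)).tendsto u₀)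
  -- the slot functions and the functional
  set E : Fin (4 * q + 3 + 1) → (Fin (4 * q + 3) → ℝ) → ℂ → ℂ :=
    fun j u' τ => if 0 < (τ + (ε / 4 : ℝ)).re then M (ψX j u') (ψU j u') (τ + (ε / 4 : ℝ)) else 0 with hE
  set S : (Fin (4 * q + 3 + 1) → ℝ) → ℂ := fun u => bumpFn ρ S₁ (q + 2) (conf ε σ (fun l => max (u l) 0)) with hS
  -- (hSc) continuity of the functional
  have hSc : Continuous S := (continuous_bumpFn ρ S₁).comp ((continuous_conf ε σ).comp (continuous_clamp _))
  -- (hSb) uniform bound of the functional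
  have hSb : ∀ u, ‖S u‖ ≤ (|B (q + 2)| * I ^ (q + 2)) * (1 + ‖u‖) ^ 0 := by
    intro u
    rw [pow_zero, mul_one]
    refine norm_apply_prodBumps_le hρ (hB' (q + 2)) fun i i' hii' => ?_
    have := le_dist_conf hε0 σ (clamp_nonneg u) hii'
    rw [hδ]; linarith
  -- (hEd) holomorphy of the slots on the open sector
  have hEd : ∀ j u', DifferentiableOn ℂ (E j u') (openSector (Real.pi / 2)) := by
    intro j u'
    have hmaps : Set.MapsTo (fun τ : ℂ => τ + (ε / 4 : ℝ)) (openSector (Real.pi / 2)) {τ : ℂ | 0 < τ.re} := by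
      intro τ hτ
      simp only [Set.mem_setOf_eq, Complex.add_re, Complex.ofReal_re]
      have := hτ.1; positivity
    have hd : DifferentiableOn ℂ (fun τ => M (ψX j u') (ψU j u') (τ + (ε / 4 : ℝ))) (openSector (Real.pi / 2)) :=
      (hholo _ _).comp (differentiableOn_id.add_const _) hmaps
    refine hd.congr fun τ hτ => ?_
    have h' : 0 < (τ + ((ε / 4 : ℝ) : ℂ)).re := hmaps hτ
    simp only [hE]
    rw [if_pos h']
  -- (hEc) continuity of the slots in the reduced gaps
  have hEc : ∀ j τ, Continuous fun u' => E j u' τ := by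
    intro j τ
    by_cases hτ : 0 < (τ + (ε / 4 : ℝ)).re
    · simp only [hE, if_pos hτ]
      rw [continuous_iff_continuousAt]
      intro u₀
      rw [ContinuousAt, tendsto_iff_norm_sub_tendsto_zero]
      have hbound : ∀ u', ‖M (ψX j u') (ψU j u') (τ + (ε / 4 : ℝ)) - M (ψX j u₀) (ψU j u₀) (τ + (ε / 4 : ℝ))‖ ≤
          2 * ‖ψX j u' - ψX j u₀‖ * KU j + 2 * ‖ψX j u₀‖ * ‖ψU j u' - ψU j u₀‖ := fun u' =>
        (hlip _ _ _ _ _ hτ).trans (add_le_add (mul_le_mul_of_nonneg_left (hψUb j u') (by positivity)) le_rfl)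
      refine squeeze_zero (fun u' => norm_nonneg _) hbound ?_
      have h1 : Tendsto (fun u' => ψX j u' - ψX j u₀) (𝓝 u₀) (𝓝 0) := by
        simpa using ((hψXc j).tendsto u₀).sub_const (ψX j u₀)
      have h2 : Tendsto (fun u' => ψU j u' - ψU j u₀) (𝓝 u₀) (𝓝 0) := by
        simpa using ((hψUc j).tendsto u₀).sub_const (ψU j u₀)
      have h1' := (tendsto_norm_zero.comp h1)
      have h2' := (tendsto_norm_zero.comp h2)
      have := ((h1'.const_mul 2).mul_const (KU j)).add ((h2'.const_mul (2 * ‖ψX j u₀‖)))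
      simpa using this
    · simp only [hE, if_neg hτ]
      exact continuous_const
  -- (hCN) sector bounds of the slots (uniform)
  have hCN : ∀ (j : Fin (4 * q + 3 + 1)) (c : ℝ), c < Real.pi / 2 → ∀ (u' : Fin (4 * q + 3) → ℝ) (τ : ℂ),
      0 < τ.re → |τ.arg| ≤ c → ‖E j u' τ‖ ≤ (2 * KX j * KU j) * (1 + ‖u'‖) ^ 0 := by
    intro j c _ u' τ hτ _
    have hτ' : 0 < (τ + (ε / 4 : ℝ)).re := by
      simp only [Complex.add_re, Complex.ofReal_re]; positivity
    rw [pow_zero, mul_one]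
    simp only [hE, if_pos hτ']
    calc ‖M (ψX j u') (ψU j u') (τ + (ε / 4 : ℝ))‖ ≤ 2 * ‖ψX j u'‖ * ‖ψU j u'‖ := hbd _ _ _ hτ'
      _ ≤ 2 * KX j * KU j := by
          have := hψXb j u'; have := hψUb j u'
          gcongr
  -- (hES) the slots represent the functional
  have hES : ∀ (j : Fin (4 * q + 3 + 1)) (u' : Fin (4 * q + 3) → ℝ), (∀ l, 0 ≤ u' l) →
      ∀ x : ℝ, 0 ≤ x → E j u' x = S (j.insertNth x u') := by
    intro j u' hu' x hx
    have hτ' : 0 < ((x : ℂ) + (ε / 4 : ℝ)).re := by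
      simp only [Complex.add_re, Complex.ofReal_re]; positivity
    simp only [hE, if_pos hτ', hS]
    have hcast : (x : ℂ) + ((ε / 4 : ℝ) : ℂ) = ((x + ε / 4 : ℝ) : ℂ) := by push_cast; ring
    rw [hcast, hψX, hψU, hreal _ _ _ _ (hX j u') (hU j u') (x + ε / 4) (by positivity)]
    -- undo the `−ε/4` shift of the upper cluster
    have hU' : prodBumps ρ (q + 1 - (gapEquiv q j).2) (cU j u') =
        translateMulti (timeVec (-(ε / 4)))
          (prodBumps ρ (q + 1 - (gapEquiv q j).2)
            (upC ε σ (j.insertNth (0 : ℝ) (fun l => max (u' l) 0)) (gapEquiv q j).1 (gapEquiv q j).2)) := by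
      rw [hcU, prodBumps_add_const]
    rw [hU', translateMulti_translateMulti, ← timeVec_add, show x + ε / 4 + -(ε / 4) = x by ring, hcX,
      apply_osAdjoint_appendTensor_cut hρ hε0 h2r hρP hρre htrans hE3 hsigned σ j hx (clamp_nonneg u'),
      clamp_insertNth j hx u']
  -- the engine
  obtain ⟨G, hG, hGS⟩ := LogSlot.exists_holomorphic_extension_sectorRegion S E one_pos (by positivity) le_rfl hSc hSb
    hEc hEd (fun j _ => 2 * KX j * KU j) (fun _ => 0) (fun j _ => by positivity) hCN hES
  refine ⟨G, hG, fun u hu => ?_⟩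
  rw [hGS u hu, hS]
  simp only
  congr 2
  funext l
  exact max_eq_left (hu l).le

end Sector

end Summit.QuantumFields.YangMills.Theorems.OSLegsAtWeakCouplingC.Loc

end
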